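import Literature.Analysis.FluidPDE.SteadyNavierStokes
import Literature.Analysis.FluidPDE.SteadyGalerkinApprox
import Literature.Analysis.FluidPDE.EnergySpaceRellich
import Literature.Analysis.FluidPDE.NSHopfGalerkinLimit
import HarnessLib

/-!
# Existence of steady weak solutions of the forced Navier–Stokes equations on `T^d` (proofs)

This file **discharges** the named fact `Torus.Temam1979_exists_steadyWeakSolution`
(`Literature.Analysis.FluidPDE.SteadyNavierStokes`; Temam 1979, Ch. II §1, Thm. 1.2, in the
space-periodic mean-zero setting of Ch. I §1.4): for `ν > 0` and `f ∈ L²(T^d; ℝ^d)` there is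
`u ∈ V` (`Torus.energySpaceV`) which is a steady weak solution
(`Torus.IsSteadyWeakSolution ν f u`: `(f, w) + ν (u, Δw) + ∫ (u ⊗ u) : ∇w = 0` for every smooth
divergence-free mean-zero `w`).

## The printed argument and its formalisation

Temam (1979), Ch. II §1, proof of Thm. 1.2: (i) the Galerkin approximations `u_m` exist by the
acute angle lemma (Lemma 1.4, Brouwer); (ii) the a priori bound `ν ‖u_m‖ ≤ ‖f‖_{V'}` follows
from `b(u_m, u_m, u_m) = 0`; (iii) a subsequence converges weakly in `V` and — by the compactness
of `V ⊂ H` — strongly in `H`, which suffices to pass to the limit in the trilinear term against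
a fixed test field; the limit solves the weak equations for the Galerkin test fields, hence, by
density/continuity, for all of them. In the tree, steps (i)–(ii) are
`exists_steady_galerkin_approx` / `steady_galerkin_bounds` (`SteadyGalerkinApprox`, built on
`exists_galerkinRHS_eq_zero` of `NSGalerkinStationary` and the Brouwer acute angle lemma
`Brouwer.exists_zero_of_bilin_coercive`): smooth divergence-free mean-zero trigonometric
polynomials `u_N` on the punctured frequency balls `S_N = {0 < |k|² ≤ N²}` with
`‖∇u_N‖² ≤ 4π²Λ`, `∫ ‖u_N‖² ≤ Λ`, `Λ = ‖f‖²_{L²} / (4π²ν)²`, solving the Galerkin equations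
`∫ (⟪u_N, (u_N·∇)a⟫ + ν ⟪u_N, Δa⟫ + ⟪f, a⟫) = 0` against every smooth divergence-free `a`
band-limited to `S_N`. Step (iii) is carried out here:

1. `u_N ∈ 𝒱 ⊆ H` lie in the enstrophy ball `K = {v ∈ H | ‖∇v‖² ≤ 4π²Λ}`, which is **compact in
   `H`** (Rellich on the torus energy space, `Torus.isCompact_setOf_eGradNormSq_le`,
   `EnergySpaceRellich`); so a subsequence `u_{φ j} → u ∈ K` in `H = L²_σ`, and `u ∈ V`
   (`memSobolev_one_complexify_of_eGradNormSq_ne_top`). This replaces (equivalently) the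
   weak-`V`/strong-`H` extraction of the book.
2. For a fixed smooth test field `a` the functional
   `U ↦ ∫ (⟪U, (U·∇)a⟫ + ν ⟪U, Δa⟫ + ⟪f, a⟫)` is continuous along `L²`-convergent, `L²`-bounded
   sequences (`tendsto_integral_weakForm_of_tendsto_lintegral`, from the slice estimate
   `Torus.enorm_sliceFunctional_sub_le` of the Hopf–Galerkin limit theory); since a field
   band-limited to `S_M` is band-limited to `S_N`, `N ≥ M`, the limit `u` satisfies the Galerkin
   equations against every band-limited smooth divergence-free test field.
3. For a general smooth divergence-free mean-zero `w`, the Fourier truncations `P_M w` are such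
   test fields (transversality of the coefficients, vanishing zero mode), and
   `P_M w → w` uniformly with first and second derivatives
   (`Torus.norm_sub_fourierTruncate_apply_le`, `TorusFourierSeries`), so the equation passes to
   the limit `M → ∞` (`tendsto_integral_weakForm_fourierTruncate`); finally the tested equation
   is `Torus.nsGeneratorPairing ν f u w = 0` (`integral_weakForm_eq`).

The hypothesis `d ≤ 4` of the named fact is not needed for existence with smooth test fields (it
enters Temam's statement through the continuity of `b` on `V³`, i.e. for the energy *equation*
and for testing with `v ∈ V`, cf. `SteadyNavierStokesEnergy`); the proof below is dimension
independent.

Main results: `exists_mem_energySpaceV_isSteadyWeakSolution` (every universe) and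
`Temam1979_exists_steadyWeakSolution_holds`.

## References

* R. Temam, *Navier–Stokes Equations: Theory and Numerical Analysis*, North-Holland (1977;
  rev. ed. 1979), Ch. II §1, Thm. 1.2 (proof (i)–(iii), (1.25)–(1.33)), Lemma 1.4; Ch. I §1.4
  (space-periodic case). [Temam1979]
* P. Constantin, C. Foias, *Navier–Stokes Equations*, Univ. Chicago Press (1988), Ch. 8,
  (8.3)–(8.7) (Fourier–Galerkin on the torus). [ConstantinFoias1988]
* J. C. Robinson, J. L. Rodrigo, W. Sadowski, *The Three-Dimensional Navier–Stokes Equations*,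
  CUP (2016), Thm. 4.4 Step 4 (band-limited test fields, then all). [RobinsonRodrigoSadowski2016]
-/

noncomputable section

open MeasureTheory Filter Topology UnitAddTorus Set
open scoped InnerProductSpace RealInnerProductSpace ENNReal NNReal

namespace Literature.Analysis.FluidPDE

namespace Torus

open FunctionSpaces FunctionSpaces.Torus

variable {d : Type*} [Fintype d] [DecidableEq d]

/-! ### Bookkeeping -/

omit [Fintype d] [DecidableEq d] in
/-- A continuous function on the (compact) torus is bounded. [folklore] -/
theorem exists_forall_norm_le_of_continuous_torus {F : Type*} [NormedAddCommGroup F]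
    {g : UnitAddTorus d → F} (hg : Continuous g) : ∃ K : ℝ, ∀ x, ‖g x‖ ≤ K := by
  obtain ⟨K, hK⟩ := isCompact_univ.exists_bound_of_continuousOn hg.continuousOn
  exact ⟨K, fun x => hK x (mem_univ x)⟩

omit [DecidableEq d] in
/-- The spectral `‖∇·‖₂²` only sees the a.e.-class (its Fourier coefficients do,
`Torus.mFourierCoeff_congr_ae`). [folklore] -/
theorem eGradNormSq_congr_ae_field {v w : UnitAddTorus d → EuclideanSpace ℝ d}
    (h : v =ᵐ[volume] w) : eGradNormSq v = eGradNormSq w := by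
  have h' : (EuclideanSpace.complexify ∘ v) =ᵐ[volume] (EuclideanSpace.complexify ∘ w) :=
    h.fun_comp EuclideanSpace.complexify
  unfold eGradNormSq eHomSobolevSeminorm
  simp_rw [mFourierCoeff_congr_ae h']

omit [DecidableEq d] in
/-- `∫⁻ ‖w₁ − w₂‖ₑ² = ‖w₁ − w₂‖ₑ²` for `L²` classes and their representatives (Parseval on both
sides, `Torus.enorm_sq_coe_eq_tsum`). [folklore] -/
theorem lintegral_enorm_coe_sub_coe_sq
    (w₁ w₂ : Lp (EuclideanSpace ℝ d) 2 (volume : Measure (UnitAddTorus d))) :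
    ∫⁻ x, ‖(w₁ : UnitAddTorus d → EuclideanSpace ℝ d) x -
        (w₂ : UnitAddTorus d → EuclideanSpace ℝ d) x‖ₑ ^ 2 = ‖w₁ - w₂‖ₑ ^ 2 := by
  rw [enorm_sq_coe_eq_tsum, tsum_enorm_sq_mFourierCoeff_complexify (Lp.memLp _)]
  refine lintegral_congr_ae ?_
  filter_upwards [Lp.coeFn_sub w₁ w₂] with x hx
  rw [hx, Pi.sub_apply]

omit [DecidableEq d] in
/-- **`L²` fields of finite enstrophy lie in `H¹`**: if `u ∈ L²(T^d; ℝ^d)` and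
`‖∇u‖₂² = 4π² ∑ |k|² ‖û(k)‖² < ∞` then `complexify ∘ u ∈ H¹(T^d)`
(`⟨k⟩² = 1 + |k|²`, so `‖u‖²_{H¹} = ‖u‖²_{L²} + ‖∇u‖₂²/4π²`; Temam 1979, Ch. I §1.4 / FMRT 2001,
Ch. II (5.6)). [folklore] -/
theorem memSobolev_one_complexify_of_eGradNormSq_ne_top {u : UnitAddTorus d → EuclideanSpace ℝ d}
    (hu : MemLp u 2 volume) (hG : eGradNormSq u ≠ ∞) :
    MemSobolev 1 (EuclideanSpace.complexify ∘ u) := by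
  refine ⟨integrable_complexify_comp (hu.integrable one_le_two), ?_⟩
  have hw : ∀ k : d → ℤ, ENNReal.ofReal (sobolevWeight 1 k ^ 2) =
      1 + ENNReal.ofReal (freqNormSq k) := by
    intro k
    rw [sobolevWeight, ← Real.rpow_natCast,
      ← Real.rpow_mul (by linarith [freqNormSq_nonneg k])]
    norm_num
    rw [ENNReal.ofReal_add zero_le_one (freqNormSq_nonneg k), ENNReal.ofReal_one]
  have h1 : ∫⁻ x, ‖u x‖ₑ ^ 2 < ∞ := lintegral_enorm_sq_lt_top_of_memLp hu
  have h2 : ∑' k : d → ℤ, ENNReal.ofReal (freqNormSq k) *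
      ‖mFourierCoeff (EuclideanSpace.complexify ∘ u) k‖ₑ ^ 2 < ∞ := by
    by_contra h
    rw [not_lt, top_le_iff] at h
    apply hG
    rw [eGradNormSq_eq_tsum, h, ENNReal.mul_top (ENNReal.ofReal_pos.2 (by positivity)).ne']
  unfold eSobolevNorm
  refine ENNReal.rpow_lt_top_of_nonneg (by norm_num) (ne_of_lt ?_)
  simp_rw [hw, add_mul, one_mul]
  rw [ENNReal.tsum_add, tsum_enorm_sq_mFourierCoeff_complexify hu]
  exact ENNReal.add_lt_top.2 ⟨h1, h2⟩

/-- The convective pairing `x ↦ ⟪U x, ((U·∇)b)(x)⟫` of an `L²` field against a smooth `b` is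
integrable (`|⟪U, (U·∇)b⟫| ≤ (∑ᵢ sup ‖∂ᵢ b‖) ‖U‖²`). [folklore] -/
theorem integrable_inner_convect_of_memLp {U : UnitAddTorus d → EuclideanSpace ℝ d}
    (hU : MemLp U 2 volume) {b : UnitAddTorus d → EuclideanSpace ℝ d} (hb : IsSmooth b) :
    Integrable (fun x => ⟪U x, FunctionSpaces.Torus.convect U b x⟫_ℝ) volume := by
  obtain ⟨C, hC⟩ := exists_forall_norm_le_of_continuous_torus
    (continuous_finsetSum Finset.univ fun i _ => (hb.partialDeriv i).continuous.norm)
  have hC' : ∀ x, ∑ i, ‖FunctionSpaces.Torus.partialDeriv i b x‖ ≤ C := fun x =>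
    (Real.le_norm_self _).trans (hC x)
  refine Integrable.mono' ((hU.integrable_norm_pow two_ne_zero).const_mul C)
    (aestronglyMeasurable_inner_convect hU.1 hb) (ae_of_all _ fun x => ?_)
  rw [Real.norm_eq_abs]
  refine (abs_real_inner_le_norm _ _).trans ?_
  have h1 := norm_convect_le U (hb.isContDiff (by simp)) x
  calc ‖U x‖ * ‖FunctionSpaces.Torus.convect U b x‖ ≤ ‖U x‖ * (‖U x‖ * C) :=
        mul_le_mul_of_nonneg_left (h1.trans (mul_le_mul_of_nonneg_left (hC' x) (norm_nonneg _)))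
          (norm_nonneg _)
    _ = C * ‖U x‖ ^ 2 := by ring

/-- The tested steady Navier–Stokes functional split into its three terms:
`∫ (⟪U, (U·∇)w⟫ + ν ⟪U, Δw⟫ + ⟪f, w⟫) = (f, w) + ν (U, Δw) + ∫ ⟪Dw·U, U⟫` for `U, f ∈ L²` and
smooth `w` (so that `Torus.nsGeneratorPairing ν f u w` is the left-hand side for `U = u`).
[folklore] -/
theorem integral_weakForm_eq (ν : ℝ) {f U : UnitAddTorus d → EuclideanSpace ℝ d}
    (hf : MemLp f 2 volume) (hU : MemLp U 2 volume) {w : UnitAddTorus d → EuclideanSpace ℝ d}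
    (hw : IsSmooth w) :
    ∫ x, (⟪U x, FunctionSpaces.Torus.convect U w x⟫_ℝ + ν * ⟪U x, laplacian w x⟫_ℝ +
        ⟪f x, w x⟫_ℝ) =
      (∫ x, ⟪f x, w x⟫_ℝ) + ν * (∫ x, ⟪U x, laplacian w x⟫_ℝ) +
        ∫ x, ⟪FunctionSpaces.Torus.fderiv w x (U x), U x⟫_ℝ := by
  have i1 : Integrable (fun x => ⟪U x, FunctionSpaces.Torus.convect U w x⟫_ℝ) volume :=
    integrable_inner_convect_of_memLp hU hw
  have i2 : Integrable (fun x => ν * ⟪U x, laplacian w x⟫_ℝ) volume :=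
    (integrable_inner_of_continuous (hU.integrable one_le_two) hw.laplacian.continuous).const_mul ν
  have i3 : Integrable (fun x => ⟪f x, w x⟫_ℝ) volume :=
    integrable_inner_of_continuous (hf.integrable one_le_two) hw.continuous
  have i12 : Integrable (fun x => ⟪U x, FunctionSpaces.Torus.convect U w x⟫_ℝ +
      ν * ⟪U x, laplacian w x⟫_ℝ) volume := i1.add i2
  rw [integral_add i12 i3, integral_add i1 i2, integral_const_mul]
  have hconv : ∫ x, ⟪U x, FunctionSpaces.Torus.convect U w x⟫_ℝ =
      ∫ x, ⟪FunctionSpaces.Torus.fderiv w x (U x), U x⟫_ℝ :=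
    integral_congr_ae (ae_of_all _ fun x => real_inner_comm _ _)
  rw [hconv]
  ring

/-! ### Continuity of the tested functional -/

/-- **Passage to the limit against a fixed smooth test field** (Temam 1979, Ch. II §1, proof
of Thm. 1.2 (iii): strong convergence in `H` suffices to pass to the limit in `b(u_m, u_m, v)`;
Robinson–Rodrigo–Sadowski 2016, Thm. 4.4 Step 4). If `U n → u` in `L²(T^d)` with
`∫ ‖U n‖² ≤ B < ∞`, then for `f ∈ L²` and smooth `a`,
`∫ (⟪U n, (U n·∇)a⟫ + ν ⟪U n, Δa⟫ + ⟪f, a⟫) → ∫ (⟪u, (u·∇)a⟫ + ν ⟪u, Δa⟫ + ⟪f, a⟫)`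
(the slice estimate `Torus.enorm_sliceFunctional_sub_le` with a free parameter `λ`).
[cite: Temam1979, Ch. II Thm. 1.2 (proof (iii))] -/
theorem tendsto_integral_weakForm_of_tendsto_lintegral {ν : ℝ}
    {f : UnitAddTorus d → EuclideanSpace ℝ d} (hf : MemLp f 2 volume)
    {U : ℕ → UnitAddTorus d → EuclideanSpace ℝ d} {u : UnitAddTorus d → EuclideanSpace ℝ d}
    (hU : ∀ n, MemLp (U n) 2 volume) (hu : MemLp u 2 volume) {B : ℝ≥0∞} (hB : B ≠ ∞)
    (hUB : ∀ n, ∫⁻ x, ‖U n x‖ₑ ^ 2 ≤ B)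
    (hlim : Tendsto (fun n => ∫⁻ x, ‖U n x - u x‖ₑ ^ 2) atTop (𝓝 0))
    {a : UnitAddTorus d → EuclideanSpace ℝ d} (ha : IsSmooth a) :
    Tendsto (fun n => ∫ x, (⟪U n x, FunctionSpaces.Torus.convect (U n) a x⟫_ℝ +
        ν * ⟪U n x, laplacian a x⟫_ℝ + ⟪f x, a x⟫_ℝ)) atTop
      (𝓝 (∫ x, (⟪u x, FunctionSpaces.Torus.convect u a x⟫_ℝ + ν * ⟪u x, laplacian a x⟫_ℝ +
        ⟪f x, a x⟫_ℝ))) := by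
  -- sup bounds of the test data
  obtain ⟨C, hC⟩ := exists_forall_norm_le_of_continuous_torus
    (continuous_finsetSum Finset.univ fun i _ => (ha.partialDeriv i).continuous.norm)
  have hC' : ∀ x, ∑ i, ‖FunctionSpaces.Torus.partialDeriv i a x‖ ≤ C := fun x =>
    (Real.le_norm_self _).trans (hC x)
  obtain ⟨KL, hKL⟩ := exists_forall_norm_le_of_continuous_torus ha.laplacian.continuous
  obtain ⟨Kq, hKq⟩ := exists_forall_norm_le_of_continuous_torus ha.continuous
  have hKp : ∀ x, ‖(0 : UnitAddTorus d → EuclideanSpace ℝ d) x‖ ≤ 0 := fun x => by simp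
  -- the functional, with a vanishing `p`-term
  set Φ : (UnitAddTorus d → EuclideanSpace ℝ d) → ℝ := fun W =>
    ∫ x, (⟪W x, FunctionSpaces.Torus.convect W a x⟫_ℝ + ν * ⟪W x, laplacian a x⟫_ℝ +
      ⟪f x, a x⟫_ℝ) with hΦ
  have hΦp : ∀ W : UnitAddTorus d → EuclideanSpace ℝ d, Φ W =
      ∫ x, (⟪W x, (0 : UnitAddTorus d → EuclideanSpace ℝ d) x⟫_ℝ +
        ⟪W x, FunctionSpaces.Torus.convect W a x⟫_ℝ + ν * ⟪W x, laplacian a x⟫_ℝ +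
        ⟪f x, a x⟫_ℝ) := fun W => by
    simp only [hΦ, Pi.zero_apply, inner_zero_right, zero_add]
  have hfu : ∫⁻ x, ‖u x‖ₑ ^ 2 < ∞ := lintegral_enorm_sq_lt_top_of_memLp hu
  have hff : ∫⁻ x, ‖f x - f x‖ₑ ^ 2 = 0 := by simp
  set Cst : ℝ≥0∞ := ENNReal.ofReal (0 ^ 2 + ν ^ 2 * KL ^ 2 + Kq ^ 2) +
    ENNReal.ofReal (C ^ 2) * (B + ∫⁻ x, ‖u x‖ₑ ^ 2) with hCst
  -- the estimate
  have key : ∀ lam : ℝ, 0 < lam → ∀ n, ‖Φ (U n) - Φ u‖ₑ ≤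
      ENNReal.ofReal lam * Cst +
        ENNReal.ofReal (2 * (2 * lam))⁻¹ * (4 * ∫⁻ x, ‖U n x - u x‖ₑ ^ 2) := by
    intro lam hlam n
    have h := enorm_sliceFunctional_sub_le (hU n) hu hf hf ha continuous_zero
      ha.laplacian.continuous hC' hKp hKL hKq ν (lam := 2 * lam) (by positivity)
    rw [← hΦp, ← hΦp, hff, add_zero, show 2 * lam / 2 = lam by ring] at h
    calc ‖Φ (U n) - Φ u‖ₑ ≤ _ := h
      _ ≤ ENNReal.ofReal (2 * (2 * lam))⁻¹ * (4 * ∫⁻ x, ‖U n x - u x‖ₑ ^ 2) +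
          ENNReal.ofReal lam * Cst := by
          rw [hCst]
          gcongr
          exact hUB n
      _ = _ := add_comm _ _
  have hzero : Tendsto (fun n => ‖Φ (U n) - Φ u‖ₑ) atTop (𝓝 0) := by
    refine ENNReal.tendsto_zero_of_forall_le_ofReal_mul_add (C := Cst)
      (X := fun lam n => ENNReal.ofReal (2 * (2 * lam))⁻¹ * (4 * ∫⁻ x, ‖U n x - u x‖ₑ ^ 2))
      ?_ ?_ ?_
    · exact ENNReal.add_ne_top.2 ⟨ENNReal.ofReal_ne_top,
        ENNReal.mul_ne_top ENNReal.ofReal_ne_top (ENNReal.add_ne_top.2 ⟨hB, hfu.ne⟩)⟩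
    · intro lam _hlam
      have h4 : Tendsto (fun n => 4 * ∫⁻ x, ‖U n x - u x‖ₑ ^ 2) atTop (𝓝 (4 * 0)) :=
        ENNReal.Tendsto.const_mul hlim (Or.inr ENNReal.ofNat_ne_top)
      rw [mul_zero] at h4
      have h5 := ENNReal.Tendsto.const_mul h4
        (Or.inr (ENNReal.ofReal_ne_top (r := (2 * (2 * lam))⁻¹)))
      rw [mul_zero] at h5
      exact h5
    · intro lam hlam
      exact Eventually.of_forall (key lam hlam)
  -- conclude
  show Tendsto (fun n => Φ (U n)) atTop (𝓝 (Φ u))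
  rw [tendsto_iff_edist_tendsto_0]
  simpa only [edist_eq_enorm_sub] using hzero

/-- **Removing the truncation of the test field** (Robinson–Rodrigo–Sadowski 2016, Thm. 4.4
Step 4, p. 77: `P_M w → w` uniformly together with its first and second derivatives for smooth
`w`). For `u, f ∈ L²` and smooth `w`,
`∫ (⟪u, (u·∇)P_M w⟫ + ν ⟪u, ΔP_M w⟫ + ⟪f, P_M w⟫) → ∫ (⟪u, (u·∇)w⟫ + ν ⟪u, Δw⟫ + ⟪f, w⟫)` as
`M → ∞`, the error being bounded by the lattice tails `∑_{k ∉ ball M} ‖ŵ(k)‖` of `w`, `Δw` and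
`∂ᵢ w` (`Torus.norm_sub_fourierTruncate_apply_le`).
[cite: RobinsonRodrigoSadowski2016, Thm. 4.4 Step 4] -/
theorem tendsto_integral_weakForm_fourierTruncate (ν : ℝ)
    {f u : UnitAddTorus d → EuclideanSpace ℝ d} (hf : MemLp f 2 volume) (hu : MemLp u 2 volume)
    {w : UnitAddTorus d → EuclideanSpace ℝ d} (hw : IsSmooth w) :
    Tendsto (fun M => ∫ x, (⟪u x, FunctionSpaces.Torus.convect u (fourierTruncate M w) x⟫_ℝ +
        ν * ⟪u x, laplacian (fourierTruncate M w) x⟫_ℝ + ⟪f x, fourierTruncate M w x⟫_ℝ)) atTop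
      (𝓝 (∫ x, (⟪u x, FunctionSpaces.Torus.convect u w x⟫_ℝ + ν * ⟪u x, laplacian w x⟫_ℝ +
        ⟪f x, w x⟫_ℝ))) := by
  -- lattice tails of the Fourier coefficients of a field
  set T : (UnitAddTorus d → EuclideanSpace ℝ d) → ℕ → ℝ := fun b M =>
    ∑' k : {k // k ∉ freqBall (d := d) M}, ‖mFourierCoeff (EuclideanSpace.complexify ∘ b) k‖
    with hT
  have hT0 : ∀ b M, 0 ≤ T b M := fun b M => tsum_nonneg fun _ => norm_nonneg _
  have hTlim : ∀ b : UnitAddTorus d → EuclideanSpace ℝ d, Tendsto (T b) atTop (𝓝 0) := fun b =>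
    (tendsto_tsum_compl_atTop_zero fun k : d → ℤ =>
      ‖mFourierCoeff (EuclideanSpace.complexify ∘ b) k‖).comp tendsto_freqBall_atTop
  set Iu : ℝ := ∫ x, ‖u x‖ ^ 2 with hIu
  set If : ℝ := ∫ x, ‖f x‖ ^ 2 with hIf
  -- the error majorant
  set g : ℕ → ℝ := fun M =>
    (|ν| * T (laplacian w) M / 2 + ∑ i, T (FunctionSpaces.Torus.partialDeriv i w) M) * Iu +
      T w M / 2 * If + (|ν| * T (laplacian w) M / 2 + T w M / 2) with hg
  have hglim : Tendsto g atTop (𝓝 0) := by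
    have h0 := hTlim w
    have h2 := hTlim (laplacian w)
    have h3 : Tendsto (fun M => ∑ i, T (FunctionSpaces.Torus.partialDeriv i w) M) atTop (𝓝 0) := by
      have := tendsto_finsetSum (Finset.univ : Finset d) fun i _ =>
        hTlim (FunctionSpaces.Torus.partialDeriv i w)
      rwa [Finset.sum_const_zero] at this
    have hA : Tendsto (fun M => |ν| * T (laplacian w) M / 2 +
        ∑ i, T (FunctionSpaces.Torus.partialDeriv i w) M) atTop (𝓝 (|ν| * 0 / 2 + 0)) :=
      ((h2.const_mul |ν|).div_const 2).add h3
    have hB : Tendsto (fun M => T w M / 2) atTop (𝓝 (0 / 2)) := h0.div_const 2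
    have hC : Tendsto (fun M => |ν| * T (laplacian w) M / 2 + T w M / 2) atTop
        (𝓝 (|ν| * 0 / 2 + 0 / 2)) := ((h2.const_mul |ν|).div_const 2).add (h0.div_const 2)
    have h := ((hA.mul_const Iu).add (hB.mul_const If)).add hC
    simp only [mul_zero, zero_div, add_zero, zero_mul] at h
    exact h
  -- integrability
  have iu : Integrable (fun x => ‖u x‖ ^ 2) volume := hu.integrable_norm_pow two_ne_zero
  have iF : Integrable (fun x => ‖f x‖ ^ 2) volume := hf.integrable_norm_pow two_ne_zero
  have hint : ∀ {b : UnitAddTorus d → EuclideanSpace ℝ d}, IsSmooth b →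
      Integrable (fun x => ⟪u x, FunctionSpaces.Torus.convect u b x⟫_ℝ +
        ν * ⟪u x, laplacian b x⟫_ℝ + ⟪f x, b x⟫_ℝ) volume := fun hb =>
    ((integrable_inner_convect_of_memLp hu hb).add ((integrable_inner_of_continuous
      (hu.integrable one_le_two) hb.laplacian.continuous).const_mul ν)).add
      (integrable_inner_of_continuous (hf.integrable one_le_two) hb.continuous)
  -- the bound `|Φ(w) - Φ(P_M w)| ≤ g M`
  have hbound : ∀ M,
      |(∫ x, (⟪u x, FunctionSpaces.Torus.convect u w x⟫_ℝ + ν * ⟪u x, laplacian w x⟫_ℝ +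
          ⟪f x, w x⟫_ℝ)) -
        ∫ x, (⟪u x, FunctionSpaces.Torus.convect u (fourierTruncate M w) x⟫_ℝ +
          ν * ⟪u x, laplacian (fourierTruncate M w) x⟫_ℝ + ⟪f x, fourierTruncate M w x⟫_ℝ)| ≤
      g M := by
    intro M
    have hP : IsSmooth (fourierTruncate M w) := isSmooth_fourierTruncate M w
    rw [← integral_sub (hint hw) (hint hP)]
    -- pointwise
    have hpt : ∀ x,
        |⟪u x, FunctionSpaces.Torus.convect u w x⟫_ℝ + ν * ⟪u x, laplacian w x⟫_ℝ + ⟪f x, w x⟫_ℝ -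
          (⟪u x, FunctionSpaces.Torus.convect u (fourierTruncate M w) x⟫_ℝ +
            ν * ⟪u x, laplacian (fourierTruncate M w) x⟫_ℝ + ⟪f x, fourierTruncate M w x⟫_ℝ)| ≤
        (|ν| * T (laplacian w) M / 2 + ∑ i, T (FunctionSpaces.Torus.partialDeriv i w) M) *
            ‖u x‖ ^ 2 +
          T w M / 2 * ‖f x‖ ^ 2 + (|ν| * T (laplacian w) M / 2 + T w M / 2) := by
      intro x
      have hd : ⟪u x, FunctionSpaces.Torus.convect u w x⟫_ℝ + ν * ⟪u x, laplacian w x⟫_ℝ +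
            ⟪f x, w x⟫_ℝ -
          (⟪u x, FunctionSpaces.Torus.convect u (fourierTruncate M w) x⟫_ℝ +
            ν * ⟪u x, laplacian (fourierTruncate M w) x⟫_ℝ + ⟪f x, fourierTruncate M w x⟫_ℝ) =
          ⟪u x, (0 : EuclideanSpace ℝ d)⟫_ℝ +
            ⟪u x, FunctionSpaces.Torus.convect u (fun y => w y - fourierTruncate M w y) x⟫_ℝ +
            ν * ⟪u x, laplacian w x - fourierTruncate M (laplacian w) x⟫_ℝ +
            ⟪f x, w x - fourierTruncate M w x⟫_ℝ := by
        rw [convect_sub_apply hw hP, laplacian_fourierTruncate hw]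
        simp only [inner_sub_right, inner_zero_right]
        ring
      rw [hd]
      have hsum : ∑ i, ‖FunctionSpaces.Torus.partialDeriv i
          (fun y => w y - fourierTruncate M w y) x‖ ≤
          ∑ i, T (FunctionSpaces.Torus.partialDeriv i w) M := by
        refine Finset.sum_le_sum fun i _ => ?_
        rw [partialDeriv_sub_apply hw hP i x, partialDeriv_fourierTruncate hw M i x]
        exact norm_sub_fourierTruncate_apply_le (hw.partialDeriv i) M x
      have hdc : ‖FunctionSpaces.Torus.convect u (fun y => w y - fourierTruncate M w y) x‖ ≤
          ‖u x‖ * ∑ i, T (FunctionSpaces.Torus.partialDeriv i w) M :=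
        (norm_convect_le u ((hw.sub hP).isContDiff (by simp)) x).trans
          (mul_le_mul_of_nonneg_left hsum (norm_nonneg _))
      have h := abs_weakIntegrand_trunc_le (u x) (f x) (0 : EuclideanSpace ℝ d)
        (FunctionSpaces.Torus.convect u (fun y => w y - fourierTruncate M w y) x)
        (laplacian w x - fourierTruncate M (laplacian w) x) (w x - fourierTruncate M w x) ν
        (hT0 w M) le_rfl (hT0 (laplacian w) M) (norm_zero (E := EuclideanSpace ℝ d)).le
        (norm_sub_fourierTruncate_apply_le hw.laplacian M x)
        (norm_sub_fourierTruncate_apply_le hw M x) hdc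
      exact h.trans (le_of_eq (by ring))
    -- integrate
    have i12 : Integrable (fun x =>
        (|ν| * T (laplacian w) M / 2 + ∑ i, T (FunctionSpaces.Torus.partialDeriv i w) M) *
          ‖u x‖ ^ 2 + T w M / 2 * ‖f x‖ ^ 2) volume := (iu.const_mul _).add (iF.const_mul _)
    have i123 : Integrable (fun x =>
        (|ν| * T (laplacian w) M / 2 + ∑ i, T (FunctionSpaces.Torus.partialDeriv i w) M) *
          ‖u x‖ ^ 2 + T w M / 2 * ‖f x‖ ^ 2 + (|ν| * T (laplacian w) M / 2 + T w M / 2)) volume :=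
      i12.add (integrable_const _)
    calc |∫ x, (⟪u x, FunctionSpaces.Torus.convect u w x⟫_ℝ + ν * ⟪u x, laplacian w x⟫_ℝ +
            ⟪f x, w x⟫_ℝ -
          (⟪u x, FunctionSpaces.Torus.convect u (fourierTruncate M w) x⟫_ℝ +
            ν * ⟪u x, laplacian (fourierTruncate M w) x⟫_ℝ + ⟪f x, fourierTruncate M w x⟫_ℝ))|
        = ‖∫ x, (⟪u x, FunctionSpaces.Torus.convect u w x⟫_ℝ + ν * ⟪u x, laplacian w x⟫_ℝ +
            ⟪f x, w x⟫_ℝ -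
          (⟪u x, FunctionSpaces.Torus.convect u (fourierTruncate M w) x⟫_ℝ +
            ν * ⟪u x, laplacian (fourierTruncate M w) x⟫_ℝ + ⟪f x, fourierTruncate M w x⟫_ℝ))‖ :=
          (Real.norm_eq_abs _).symm
      _ ≤ ∫ x, ((|ν| * T (laplacian w) M / 2 +
              ∑ i, T (FunctionSpaces.Torus.partialDeriv i w) M) * ‖u x‖ ^ 2 +
            T w M / 2 * ‖f x‖ ^ 2 + (|ν| * T (laplacian w) M / 2 + T w M / 2)) :=
          norm_integral_le_of_norm_le i123 (ae_of_all _ fun x => by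
            rw [Real.norm_eq_abs]; exact hpt x)
      _ = g M := by
          rw [integral_add i12 (integrable_const _), integral_add (iu.const_mul _) (iF.const_mul _),
            integral_const_mul, integral_const_mul, integral_const]
          simp [hg, hIu, hIf, Measure.real]
  -- conclude
  rw [tendsto_iff_norm_sub_tendsto_zero]
  refine squeeze_zero (fun M => norm_nonneg _) (fun M => ?_) hglim
  rw [Real.norm_eq_abs, abs_sub_comm]
  exact hbound M

/-! ### The Galerkin sequence and the limit -/

/-- **The stationary Galerkin sequence** (Temam 1979, Ch. II §1, proof of Thm. 1.2 (i)–(ii),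
(1.25)–(1.30), on the punctured frequency balls `S_N = {0 < |k|² ≤ N²}` of `T^d`;
`exists_steady_galerkin_approx` and `steady_galerkin_bounds` repackaged as vector fields): for
`ν > 0` and `f ∈ L²` there are smooth divergence-free mean-zero fields `U N` with
`‖∇U N‖² ≤ 4π²Λ`, `∫ ‖U N‖² ≤ Λ`, `Λ = (∫ ‖f‖²)/(4π²ν)²`, solving
`∫ (⟪U N, (U N·∇)a⟫ + ν ⟪U N, Δa⟫ + ⟪f, a⟫) = 0` for every smooth divergence-free `a`
band-limited to `S_N`. [cite: Temam1979, Ch. II Thm. 1.2 (proof, (1.25)–(1.30))] -/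
theorem exists_steady_galerkin_sequence {ν : ℝ} (hν : 0 < ν)
    {f : UnitAddTorus d → EuclideanSpace ℝ d} (hf : MemLp f 2 volume) :
    ∃ U : ℕ → UnitAddTorus d → EuclideanSpace ℝ d,
      (∀ N, IsSmooth (U N)) ∧ (∀ N, IsDivFree (U N)) ∧ (∀ N, HasZeroMean (U N)) ∧
      (∀ N, eGradNormSq (U N) ≤
        ENNReal.ofReal (4 * Real.pi ^ 2 * ((∫ x, ‖f x‖ ^ 2) / (4 * Real.pi ^ 2 * ν) ^ 2))) ∧
      (∀ N, ∫⁻ x, ‖U N x‖ₑ ^ 2 ≤ ENNReal.ofReal ((∫ x, ‖f x‖ ^ 2) / (4 * Real.pi ^ 2 * ν) ^ 2)) ∧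
      ∀ N (a : UnitAddTorus d → EuclideanSpace ℝ d), IsSmooth a → IsDivFree a →
        (∀ k ∉ (freqBall (d := d) N).erase 0,
          mFourierCoeff (EuclideanSpace.complexify ∘ a) k = 0) →
        ∫ x, (⟪U N x, FunctionSpaces.Torus.convect (U N) a x⟫_ℝ + ν * ⟪U N x, laplacian a x⟫_ℝ +
          ⟪f x, a x⟫_ℝ) = 0 := by
  classical
  choose C hCsymm hCtr hCsupp hCbd _hCen hCtest using
    fun N : ℕ => exists_steady_galerkin_approx (d := d) hν hf N
  refine ⟨fun N => realTrigPoly ((freqBall (d := d) N).erase 0) (C N),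
    fun N => isSmooth_realTrigPoly _ _, fun N => isDivFree_realTrigPoly fun k _ => hCtr N k,
    fun N => hasZeroMean_realTrigPoly_of_zero_not_mem (by simp) (C N), fun N => ?_, fun N => ?_,
    fun N a ha hdiv hband => hCtest N a ha hdiv hband⟩
  · exact (steady_galerkin_bounds hν (hCsymm N) (hCsupp N) (hCbd N)).1
  · have h := (steady_galerkin_bounds hν (hCsymm N) (hCsupp N) (hCbd N)).2.1
    have hm : MemLp (realTrigPoly ((freqBall (d := d) N).erase 0) (C N)) 2 volume :=
      memLp_realTrigPoly _ _ 2
    calc ∫⁻ x, ‖realTrigPoly ((freqBall (d := d) N).erase 0) (C N) x‖ₑ ^ 2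
        = ENNReal.ofReal (∫ x, ‖realTrigPoly ((freqBall (d := d) N).erase 0) (C N) x‖ ^ 2) := by
          rw [ofReal_integral_eq_lintegral_ofReal (hm.integrable_norm_pow two_ne_zero)
            (ae_of_all _ fun x => by positivity)]
          refine lintegral_congr fun x => ?_
          rw [← ofReal_norm, ← ENNReal.ofReal_pow (norm_nonneg _)]
      _ ≤ _ := ENNReal.ofReal_le_ofReal h

/-- **Existence of steady weak solutions of the forced Navier–Stokes equations on `T^d`, every
viscosity** (Temam 1979, Ch. II §1, Thm. 1.2, space-periodic mean-zero setting of Ch. I §1.4;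
every universe and every dimension). For `ν > 0` and `f ∈ L²(T^d; ℝ^d)` there is `u ∈ V` with
`(f, w) + ν (u, Δw) + ∫ (u ⊗ u) : ∇w = 0` for all smooth divergence-free mean-zero `w`. Proof:
the Galerkin sequence of `exists_steady_galerkin_sequence` lies in a compact enstrophy ball of
`H` (`Torus.isCompact_setOf_eGradNormSq_le`); a limit point `u` has finite enstrophy (`u ∈ V`)
and, by `tendsto_integral_weakForm_of_tendsto_lintegral`, solves the equations against every
band-limited test field, hence against the truncations `P_M w` of any admissible `w`, and the
truncation is removed by `tendsto_integral_weakForm_fourierTruncate`.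
[cite: Temam1979, Ch. II Thm. 1.2] -/
theorem exists_mem_energySpaceV_isSteadyWeakSolution {ν : ℝ} (hν : 0 < ν)
    {f : UnitAddTorus d → EuclideanSpace ℝ d} (hf : MemLp f 2 volume) :
    ∃ u : energySpace d, u.1 ∈ energySpaceV d ∧ IsSteadyWeakSolution ν f u := by
  obtain ⟨U, hUs, hUdiv, hUmean, hUgrad, hUL2, hUtest⟩ := exists_steady_galerkin_sequence hν hf
  have hUm : ∀ N, MemLp (U N) 2 volume := fun N => (hUs N).memLp 2
  -- the approximations as elements of `H`
  have hmem : ∀ N, (hUm N).toLp (U N) ∈ energySpace d := fun N =>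
    smoothSolenoidal_subset_energySpace ⟨U N, hUs N, hUdiv N, hUmean N, (hUm N).coeFn_toLp⟩
  set v : ℕ → energySpace d := fun N => ⟨(hUm N).toLp (U N), hmem N⟩ with hv
  have hvae : ∀ N, ((v N).1 : UnitAddTorus d → EuclideanSpace ℝ d) =ᵐ[volume] U N := fun N =>
    (hUm N).coeFn_toLp
  -- compactness of the enstrophy ball (Rellich)
  set R : ℝ≥0∞ :=
    ENNReal.ofReal (4 * Real.pi ^ 2 * ((∫ x, ‖f x‖ ^ 2) / (4 * Real.pi ^ 2 * ν) ^ 2)) with hR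
  set K : Set (energySpace d) :=
    {u | eGradNormSq (u.1 : UnitAddTorus d → EuclideanSpace ℝ d) ≤ R} with hK
  have hKc : IsCompact K := isCompact_setOf_eGradNormSq_le ENNReal.ofReal_ne_top
  have hvK : ∀ N, v N ∈ K := fun N => by
    show eGradNormSq ((v N).1 : UnitAddTorus d → EuclideanSpace ℝ d) ≤ R
    rw [eGradNormSq_congr_ae_field (hvae N)]
    exact hUgrad N
  obtain ⟨u, huK, φ, hφ, hlim⟩ := hKc.tendsto_subseq hvK
  have huL2 : MemLp (u.1 : UnitAddTorus d → EuclideanSpace ℝ d) 2 volume := Lp.memLp _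
  have huG : eGradNormSq (u.1 : UnitAddTorus d → EuclideanSpace ℝ d) ≤ R := huK
  refine ⟨u, ⟨u.2, memSobolev_one_complexify_of_eGradNormSq_ne_top huL2
    (ne_top_of_le_ne_top ENNReal.ofReal_ne_top huG)⟩, ?_⟩
  -- strong convergence in `L²` along the subsequence
  have hconv : Tendsto (fun j => ∫⁻ x,
      ‖U (φ j) x - (u.1 : UnitAddTorus d → EuclideanSpace ℝ d) x‖ₑ ^ 2) atTop (𝓝 0) := by
    have h1 : Tendsto (fun j => (v (φ j)).1) atTop (𝓝 u.1) :=
      (continuous_subtype_val.tendsto u).comp hlim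
    have h2 := tendsto_iff_norm_sub_tendsto_zero.1 h1
    have h3 : Tendsto (fun j => ‖(v (φ j)).1 - u.1‖ₑ ^ 2) atTop (𝓝 0) := by
      have h4 := ENNReal.tendsto_ofReal h2
      rw [ENNReal.ofReal_zero] at h4
      have h5 := ((ENNReal.continuous_pow 2).tendsto 0).comp h4
      rw [zero_pow two_ne_zero] at h5
      refine h5.congr fun j => ?_
      simp only [Function.comp_apply, ofReal_norm]
    refine h3.congr fun j => ?_
    rw [← lintegral_enorm_coe_sub_coe_sq]
    refine lintegral_congr_ae ?_
    filter_upwards [hvae (φ j)] with x hx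
    rw [hx]
  -- the weak formulation
  intro w hw hwdiv hwmean
  -- the limit solves the equations against the truncations `P_M w`
  have htrunc : ∀ M : ℕ, ∫ x, (⟪(u.1 : UnitAddTorus d → EuclideanSpace ℝ d) x,
      FunctionSpaces.Torus.convect (u.1 : UnitAddTorus d → EuclideanSpace ℝ d)
        (fourierTruncate M w) x⟫_ℝ +
      ν * ⟪(u.1 : UnitAddTorus d → EuclideanSpace ℝ d) x, laplacian (fourierTruncate M w) x⟫_ℝ +
      ⟪f x, fourierTruncate M w x⟫_ℝ) = 0 := by
    intro M
    have ha : IsSmooth (fourierTruncate M w) := isSmooth_fourierTruncate M w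
    have hadiv : IsDivFree (fourierTruncate M w) :=
      isDivFree_realTrigPoly (hwdiv.isTransversal_mFourierCoeff hw (freqBall M))
    have hw0 : mFourierCoeff (EuclideanSpace.complexify ∘ w) 0 = 0 := by
      rw [mFourierCoeff_eq_integral_volume]
      simp only [neg_zero, mFourier_zero, ContinuousMap.one_apply, one_smul, Function.comp_apply]
      rw [EuclideanSpace.complexify.integral_comp_comm w, hwmean, map_zero]
    have hband : ∀ N, M ≤ N → ∀ k ∉ (freqBall (d := d) N).erase 0,
        mFourierCoeff (EuclideanSpace.complexify ∘ fourierTruncate M w) k = 0 := by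
      intro N hMN k hk
      rw [mFourierCoeff_fourierTruncate hw.integrable]
      by_cases hkM : k ∈ freqBall M
      · have hk0 : k = 0 := by
          by_contra h
          exact hk (Finset.mem_erase.2 ⟨h, freqBall_mono hMN hkM⟩)
        subst hk0
        rw [if_pos hkM, hw0]
      · rw [if_neg hkM]
    have hev : ∀ᶠ j in atTop,
        ∫ x, (⟪U (φ j) x, FunctionSpaces.Torus.convect (U (φ j)) (fourierTruncate M w) x⟫_ℝ +
          ν * ⟪U (φ j) x, laplacian (fourierTruncate M w) x⟫_ℝ +
          ⟪f x, fourierTruncate M w x⟫_ℝ) = 0 := by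
      filter_upwards [eventually_ge_atTop M] with j hj
      exact hUtest (φ j) _ ha hadiv (hband (φ j) (hj.trans (hφ.id_le j)))
    have hl := tendsto_integral_weakForm_of_tendsto_lintegral (ν := ν) hf (fun n => hUm (φ n))
      huL2 ENNReal.ofReal_ne_top (fun n => hUL2 (φ n)) hconv ha
    exact tendsto_nhds_unique hl (tendsto_const_nhds.congr' (hev.mono fun j hj => hj.symm))
  -- remove the truncation
  have hl2 := tendsto_integral_weakForm_fourierTruncate ν hf huL2 hw
  have hzero : ∫ x, (⟪(u.1 : UnitAddTorus d → EuclideanSpace ℝ d) x,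
      FunctionSpaces.Torus.convect (u.1 : UnitAddTorus d → EuclideanSpace ℝ d) w x⟫_ℝ +
      ν * ⟪(u.1 : UnitAddTorus d → EuclideanSpace ℝ d) x, laplacian w x⟫_ℝ + ⟪f x, w x⟫_ℝ) = 0 :=
    tendsto_nhds_unique hl2 (tendsto_const_nhds.congr fun M => (htrunc M).symm)
  have hfinal : nsGeneratorPairing ν f u w =
      ∫ x, (⟪(u.1 : UnitAddTorus d → EuclideanSpace ℝ d) x,
        FunctionSpaces.Torus.convect (u.1 : UnitAddTorus d → EuclideanSpace ℝ d) w x⟫_ℝ +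
        ν * ⟪(u.1 : UnitAddTorus d → EuclideanSpace ℝ d) x, laplacian w x⟫_ℝ + ⟪f x, w x⟫_ℝ) := by
    rw [integral_weakForm_eq ν hf huL2 hw]
    rfl
  rw [hfinal]
  exact hzero

/-- **Discharge of the named fact `Torus.Temam1979_exists_steadyWeakSolution`** (Temam 1979,
Ch. II §1, Thm. 1.2, space-periodic mean-zero setting): for `d ≤ 4`, `ν > 0` and
`f ∈ L²(T^d; ℝ^d)` there is a steady weak solution `u ∈ V` of the forced Navier–Stokes
equations (`exists_mem_energySpaceV_isSteadyWeakSolution`; the dimension restriction is not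
used). [cite: Temam1979, Ch. II Thm. 1.2] -/
theorem Temam1979_exists_steadyWeakSolution_holds : Temam1979_exists_steadyWeakSolution := by
  intro d _ _ _ ν hν f hf
  exact exists_mem_energySpaceV_isSteadyWeakSolution hν hf

end Torus

end Literature.Analysis.FluidPDE
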